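import Literature.Geometry.Symplectic.JHolomorphicMap
import Mathlib.Geometry.Manifold.MFDeriv.Basic
import Mathlib.Geometry.Manifold.Instances.Real
import Mathlib.Topology.UniformSpace.UniformConvergence

/-!
# The local theory of `J`-holomorphic curves in almost complex 4-manifolds (McDuff 1991; Wendl)

Five NAMED FACTS of the local intersection / singularity theory of `J`-holomorphic curves in a
smooth almost complex `4`-manifold `(V, J)` (`J² = −1`, `J` smooth in tangent coordinates), each a
published local statement, stated for smooth `J`-holomorphic maps `ℂ → V` near a point (the
germ at `z₀` of an entire map; every local statement about discs is applied to entire maps by the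
consumers) and, where limits occur, with `C⁰`-convergence expressed through an auxiliary
topological embedding `ι : V → ℝᴺ` which is a smooth injective immersion (as in
`jHolomorphicLimitOfEmbedded_isEmbedded`):

* `jHolomorphic_uniqueContinuation_const` — UNIQUE CONTINUATION from an open set: a smooth
  `J`-holomorphic `G : ℂ → V` which is constant near one point is constant
  (McDuff 1991 Lemma 2.3, Aronszajn; Wendl, Lectures, Prop. 2.54);
* `jHolomorphic_localBranchDichotomy` — LOCAL STRUCTURE at a point where `G` is not locally
  constant: EITHER `G` is injective on a small disc and immersive on the punctured disc
  (an injective germ: isolated critical points, McDuff Lemma 2.7 / Lemma 5.3), OR every point of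
  a smaller punctured disc has a distinct partner in the disc with the same image (the germ factors
  through a `k`-fold branched cover of an injective germ, `k ≥ 2`: Wendl, Lectures, Thm 2.88);
* `jHolomorphic_intersectionDichotomy` — TWO BRANCHES THROUGH ONE POINT, one of them regular:
  either the intersection is isolated (in parameter pairs), or the two branches have the same
  image germ (McDuff Lemma 2.7: accumulation points of `C ∩ C'` are critical on both curves, with
  Lemma 2.4; Wendl, Lectures, Thm 2.87/2.88);
* `jHolomorphic_isolatedIntersection_persists` — POSITIVITY OF INTERSECTIONS, persistence form: an
  isolated intersection of two branches, one of them regular at the point, persists under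
  `C⁰`-small perturbation by `J`-holomorphic maps (the local intersection index is `k_x ≥ 1`,
  McDuff Thm 1.1 and (5.1) cases (i)–(ii), and intersection numbers of disc pairs with disjoint
  boundaries are homotopy invariant, Lemma 4.2(ii));
* `jHolomorphic_immersed_of_limitEmbedded_punctured` — NO CUSPS IN LIMITS OF EMBEDDED CURVES: if
  smooth `J`-holomorphic injective immersions converge uniformly on a closed disc to a smooth
  `J`-holomorphic `G` which is injective on the disc and immersive on the punctured disc, then `G`
  is immersive at the centre (McDuff Thm 1.4: `L.Int(G, 0) > 0` at a critical point; Cor. 4.4 and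
  Lemma 4.3: a `C¹`-close `J`-holomorphic immersion has `Int = L.Int(G,0)`, Lemma 4.2(i): hence
  double points; the `C⁰ ⇒ C¹` upgrade is interior elliptic regularity, Hummel 1997 III.3.1, in
  the tree `JHolomorphicWeierstrassR4`).

Together with elementary topology these five facts prove McDuff's global-flavoured statement
`jHolomorphicLimitOfEmbedded_isEmbedded` (the limit of embedded `J`-planes with an embedded
separated collar is embedded on the disc), the input L1b of crux `WitnessCharge` / `TameOrBrodyR4` /
`GromovRecognitionRelEnd` of summit `SmoothPoincare4`: all double-point partners live in the inner
closed disc, the non-injectivity locus is then open (facts 3, 4, 2) and relatively closed, hence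
empty by connectedness, and critical points are excluded by facts 2 and 5. That reduction is
proved on the Summits side (`Theorems/SullivanDualWitnessChargeLimitEmbeddedLocal*.lean`).

Design: germs are germs of ENTIRE maps `ℂ → V` (the consumers shift and restrict entire curves;
McDuff's statements are for maps of a disc, which is more general); "regular at `z`" is
`Function.Injective (mfderiv … G z)`; "not locally constant at `z₀`" is `∃ᶠ z in 𝓝 z₀, G z ≠ G z₀`;
radii are quantified in the `∀ ρ, ∃ ρ'` form wherever partners / images of a point near the
boundary of a disc may leave that disc. Deliberately NOT here: the intersection index `k_x` and
the self-intersection number `Int` themselves, the representation formula (Wendl Thm 2.85 /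
Micallef–White), the adjunction formula (McDuff Thm 1.3), anything global.
-/

noncomputable section

open scoped Manifold ContDiff
open Set Filter _root_.Topology

namespace Literature.Geometry.Symplectic

/-- **Unique continuation from an open set for `J`-holomorphic curves (McDuff 1991 Lemma 2.3;
Aronszajn).** In a smooth almost complex `4`-manifold `(V, J)`, a smooth `J`-holomorphic
`G : ℂ → V` which is constant on a neighbourhood of some point `z₀` is constant on `ℂ`.
Source: McDuff, JDG 34 (1991), Lemma 2.3 p. 147 ("If two `J`-holomorphic curves
`f, f' : Σ → (V, J)` have the same `∞`-jet at a point `z` of a connected Riemann surface `Σ`, then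
`f = f'`" — applied to `G` and the constant curve, on `Σ = ℂ`); Wendl, *Lectures on holomorphic
curves*, Prop. 2.54.
[cite: McDuff1991LocalBehaviour, Lemma 2.3] -/
def jHolomorphic_uniqueContinuation_const : Prop :=
  ∀ (V : Type) [TopologicalSpace V] [T2Space V] [SecondCountableTopology V]
    [ChartedSpace (EuclideanSpace ℝ (Fin 4)) V] [IsManifold (𝓡 4) ∞ V]
    (J : ∀ x : V, TangentSpace (𝓡 4) x →L[ℝ] TangentSpace (𝓡 4) x),
    (∀ (x : V) (v : TangentSpace (𝓡 4) x), J x (J x v) = -v) →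
    (∀ x₀ : V, ContMDiffAt (𝓡 4) 𝓘(ℝ, EuclideanSpace ℝ (Fin 4) →L[ℝ] EuclideanSpace ℝ (Fin 4)) ∞
      (inTangentCoordinates (𝓡 4) (𝓡 4) (id : V → V) id (fun x => J x) x₀) x₀) →
    ∀ (G : ℂ → V), ContMDiff 𝓘(ℝ, ℂ) (𝓡 4) ∞ G → IsJHolomorphic (𝓡 4) J G →
      ∀ z₀ : ℂ, (∀ᶠ z in 𝓝 z₀, G z = G z₀) → ∀ z : ℂ, G z = G z₀

/-- **Local structure of a `J`-holomorphic germ in dimension 4 (McDuff 1991 Lemma 2.7, Lemma 5.3;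
Wendl, Lectures, Thm 2.88).** Let `G : ℂ → V` be smooth and `J`-holomorphic and not locally
constant at `z₀`. Then EITHER `G` is injective on some disc `ball z₀ ρ` and immersive on the
punctured disc (the germ is injective: by Wendl Thm 2.88 `G = v ∘ φ` near `z₀` with `v` an
injective `J`-curve and `φ` holomorphic, here with `φ'(z₀) ≠ 0`; critical points of `v` are
isolated, McDuff Lemma 2.7, and an injective germ with a critical point embeds a deleted
neighbourhood, Lemma 5.3), OR for every `ρ > 0` there is `ρ' > 0` such that every `t ≠ z₀` of
`ball z₀ ρ'` has a partner `s ≠ t` in `ball z₀ ρ` with `G s = G t` (the case `φ'(z₀) = 0`: `φ` is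
a `k`-fold branched cover near `z₀`, `k ≥ 2`, and the other `φ`-preimages of `φ t` are partners;
they may leave a disc only near its boundary, whence the two radii).
[cite: WendlLectures2010, Thm 2.88] -/
def jHolomorphic_localBranchDichotomy : Prop :=
  ∀ (V : Type) [TopologicalSpace V] [T2Space V] [SecondCountableTopology V]
    [ChartedSpace (EuclideanSpace ℝ (Fin 4)) V] [IsManifold (𝓡 4) ∞ V]
    (J : ∀ x : V, TangentSpace (𝓡 4) x →L[ℝ] TangentSpace (𝓡 4) x),
    (∀ (x : V) (v : TangentSpace (𝓡 4) x), J x (J x v) = -v) →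
    (∀ x₀ : V, ContMDiffAt (𝓡 4) 𝓘(ℝ, EuclideanSpace ℝ (Fin 4) →L[ℝ] EuclideanSpace ℝ (Fin 4)) ∞
      (inTangentCoordinates (𝓡 4) (𝓡 4) (id : V → V) id (fun x => J x) x₀) x₀) →
    ∀ (G : ℂ → V), ContMDiff 𝓘(ℝ, ℂ) (𝓡 4) ∞ G → IsJHolomorphic (𝓡 4) J G →
      ∀ z₀ : ℂ, (∃ᶠ z in 𝓝 z₀, G z ≠ G z₀) →
        (∃ ρ : ℝ, 0 < ρ ∧ Set.InjOn G (Metric.ball z₀ ρ) ∧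
          ∀ z ∈ Metric.ball z₀ ρ, z ≠ z₀ →
            Function.Injective (mfderiv 𝓘(ℝ, ℂ) (𝓡 4) G z)) ∨
        (∀ ρ : ℝ, 0 < ρ → ∃ ρ' : ℝ, 0 < ρ' ∧
          ∀ t ∈ Metric.ball z₀ ρ', t ≠ z₀ →
            ∃ s ∈ Metric.ball z₀ ρ, s ≠ t ∧ G s = G t)

/-- **Intersection dichotomy for two branches through a point, one of them regular
(McDuff 1991 Lemma 2.7; Wendl, Lectures, Thm 2.87/2.88).** Let `G₁, G₂ : ℂ → V` be smooth and
`J`-holomorphic with `G₁ 0 = G₂ 0`, `G₂` regular at `0` (`dG₂(0)` injective) and `G₁` not locally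
constant at `0`. Then EITHER the intersection is isolated — for some `ρ > 0` the only pair
`(s, t) ∈ ball 0 ρ × ball 0 ρ` with `G₁ s = G₂ t` is `(0, 0)` — OR the two branches have the same
image germ: for every `ρ > 0` some `ρ' > 0` has `G₁(ball 0 ρ') ⊆ G₂(ball 0 ρ)` and
`G₂(ball 0 ρ') ⊆ G₁(ball 0 ρ)`. Source: McDuff, JDG 34 (1991), Lemma 2.7 p. 150 ("if `C` and
`C'` are distinct connected `J`-holomorphic curves, then every accumulation point in the
intersection `C ∩ C'` is critical on both curves"; proof: at a point nonsingular on `C'`, either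
isolated or, by Lemma 2.4, `C = C'` locally); equivalently Wendl Thm 2.88 (factor `G₁ = v ∘ φ`
through an injective `v`) with Thm 2.87 applied to `v` and `G₂` (either `v = G₂ ∘ ψ` near `0`, or
the punctured images are disjoint near the point), the reverse inclusion by openness of the
non-constant holomorphic `φ`, `ψ`.
[cite: McDuff1991LocalBehaviour, Lemma 2.7] -/
def jHolomorphic_intersectionDichotomy : Prop :=
  ∀ (V : Type) [TopologicalSpace V] [T2Space V] [SecondCountableTopology V]
    [ChartedSpace (EuclideanSpace ℝ (Fin 4)) V] [IsManifold (𝓡 4) ∞ V]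
    (J : ∀ x : V, TangentSpace (𝓡 4) x →L[ℝ] TangentSpace (𝓡 4) x),
    (∀ (x : V) (v : TangentSpace (𝓡 4) x), J x (J x v) = -v) →
    (∀ x₀ : V, ContMDiffAt (𝓡 4) 𝓘(ℝ, EuclideanSpace ℝ (Fin 4) →L[ℝ] EuclideanSpace ℝ (Fin 4)) ∞
      (inTangentCoordinates (𝓡 4) (𝓡 4) (id : V → V) id (fun x => J x) x₀) x₀) →
    ∀ (G₁ G₂ : ℂ → V), ContMDiff 𝓘(ℝ, ℂ) (𝓡 4) ∞ G₁ → IsJHolomorphic (𝓡 4) J G₁ →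
      ContMDiff 𝓘(ℝ, ℂ) (𝓡 4) ∞ G₂ → IsJHolomorphic (𝓡 4) J G₂ →
      G₁ 0 = G₂ 0 → Function.Injective (mfderiv 𝓘(ℝ, ℂ) (𝓡 4) G₂ 0) →
      (∃ᶠ z in 𝓝 (0 : ℂ), G₁ z ≠ G₁ 0) →
        (∃ ρ : ℝ, 0 < ρ ∧ ∀ s ∈ Metric.ball (0 : ℂ) ρ, ∀ t ∈ Metric.ball (0 : ℂ) ρ,
          G₁ s = G₂ t → s = 0 ∧ t = 0) ∨
        (∀ ρ : ℝ, 0 < ρ → ∃ ρ' : ℝ, 0 < ρ' ∧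
          G₁ '' Metric.ball (0 : ℂ) ρ' ⊆ G₂ '' Metric.ball (0 : ℂ) ρ ∧
          G₂ '' Metric.ball (0 : ℂ) ρ' ⊆ G₁ '' Metric.ball (0 : ℂ) ρ)

/-- **Positivity of intersections, persistence form (McDuff 1991 Thm 1.1, (5.1), Lemma 4.2(ii)).**
Let `G₁, G₂ : ℂ → V` be smooth and `J`-holomorphic with `G₁ 0 = G₂ 0`, `G₂` regular at `0`, and
suppose the intersection is isolated within radius `ρ`: the only pair `(s, t) ∈ ball 0 ρ × ball 0 ρ`
with `G₁ s = G₂ t` is `(0, 0)`. If smooth `J`-holomorphic `uₙ → G₁` and `vₙ → G₂` uniformly on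
`closedBall 0 ρ` (through a topological embedding `ι : V → ℝᴺ` which is a smooth injective
immersion), then for all large `n` the perturbed branches still meet: `uₙ s = vₙ t` for some
`s, t ∈ ball 0 ρ`. Source: McDuff, JDG 34 (1991), Thm 1.1 p. 143 ("Each such point `x` contributes
a number `k_x ≥ 1` to the algebraic intersection number") with (5.1) cases (i)–(ii) p. 161
(`C'` nonsingular at `x`: multiplicity `k ≥ 1`, resp. `r ≥ 1`), and the homotopy invariance of
intersection numbers of pairs of discs whose boundaries avoid the other disc (Lemma 4.2(ii)); a
non-zero intersection number forces an intersection of the perturbed pair.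
[cite: McDuff1991LocalBehaviour, Thm 1.1 and (5.1)(i)-(ii)] -/
def jHolomorphic_isolatedIntersection_persists : Prop :=
  ∀ (V : Type) [TopologicalSpace V] [T2Space V] [SecondCountableTopology V]
    [ChartedSpace (EuclideanSpace ℝ (Fin 4)) V] [IsManifold (𝓡 4) ∞ V]
    (J : ∀ x : V, TangentSpace (𝓡 4) x →L[ℝ] TangentSpace (𝓡 4) x),
    (∀ (x : V) (v : TangentSpace (𝓡 4) x), J x (J x v) = -v) →
    (∀ x₀ : V, ContMDiffAt (𝓡 4) 𝓘(ℝ, EuclideanSpace ℝ (Fin 4) →L[ℝ] EuclideanSpace ℝ (Fin 4)) ∞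
      (inTangentCoordinates (𝓡 4) (𝓡 4) (id : V → V) id (fun x => J x) x₀) x₀) →
    ∀ (N : ℕ) (ι : V → EuclideanSpace ℝ (Fin N)), Topology.IsEmbedding ι →
      ContMDiff (𝓡 4) 𝓘(ℝ, EuclideanSpace ℝ (Fin N)) ∞ ι →
      (∀ x : V, Function.Injective (mfderiv (𝓡 4) 𝓘(ℝ, EuclideanSpace ℝ (Fin N)) ι x)) →
    ∀ (G₁ G₂ : ℂ → V), ContMDiff 𝓘(ℝ, ℂ) (𝓡 4) ∞ G₁ → IsJHolomorphic (𝓡 4) J G₁ →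
      ContMDiff 𝓘(ℝ, ℂ) (𝓡 4) ∞ G₂ → IsJHolomorphic (𝓡 4) J G₂ →
      G₁ 0 = G₂ 0 → Function.Injective (mfderiv 𝓘(ℝ, ℂ) (𝓡 4) G₂ 0) →
      ∀ ρ : ℝ, 0 < ρ →
        (∀ s ∈ Metric.ball (0 : ℂ) ρ, ∀ t ∈ Metric.ball (0 : ℂ) ρ, G₁ s = G₂ t → s = 0 ∧ t = 0) →
        ∀ (u v : ℕ → ℂ → V),
          (∀ n, ContMDiff 𝓘(ℝ, ℂ) (𝓡 4) ∞ (u n)) → (∀ n, IsJHolomorphic (𝓡 4) J (u n)) →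
          (∀ n, ContMDiff 𝓘(ℝ, ℂ) (𝓡 4) ∞ (v n)) → (∀ n, IsJHolomorphic (𝓡 4) J (v n)) →
          TendstoUniformlyOn (fun n z => ι (u n z)) (fun z => ι (G₁ z)) atTop
            (Metric.closedBall (0 : ℂ) ρ) →
          TendstoUniformlyOn (fun n z => ι (v n z)) (fun z => ι (G₂ z)) atTop
            (Metric.closedBall (0 : ℂ) ρ) →
          ∀ᶠ n in atTop, ∃ s ∈ Metric.ball (0 : ℂ) ρ, ∃ t ∈ Metric.ball (0 : ℂ) ρ, u n s = v n t

/-- **No cusps in limits of embedded `J`-curves (McDuff 1991 Thm 1.4, Cor. 4.4, Lemma 4.3,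
Lemma 4.2(i)).** Let `G : ℂ → V` be smooth and `J`-holomorphic, injective on `ball 0 ρ` and
immersive on the punctured disc, and let smooth `J`-holomorphic injective immersions
`uₙ : ℂ → V` converge to `G` uniformly on `closedBall 0 ρ` (through `ι` as above). Then `G` is
immersive at `0`. Source: McDuff, JDG 34 (1991): if `dG(0) = 0`, `G` restricted to a smaller
closed disc `D` is an embedding except at the critical point `0`, so `L.Int(G, 0) > 0` (Thm 1.4
p. 144) and every `J`-holomorphic immersion `f'` sufficiently `C¹`-close to `G|D` has
`Int(f') = L.Int(G, 0) ≥ 1` (Cor. 4.4 p. 160, Lemma 4.3 p. 159), hence is not an embedding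
(Lemma 4.2(i)); the `uₙ|D` are such immersions for `n` large (the `C⁰`-convergence of
`J`-holomorphic maps upgrades to `C¹` on interior discs: Hummel 1997, III.3.1; tree:
`JHolomorphicWeierstrassR4`) but are injective — contradiction.
[cite: McDuff1991LocalBehaviour, Thm 1.4, Cor. 4.4, Lemma 4.3] -/
def jHolomorphic_immersed_of_limitEmbedded_punctured : Prop :=
  ∀ (V : Type) [TopologicalSpace V] [T2Space V] [SecondCountableTopology V]
    [ChartedSpace (EuclideanSpace ℝ (Fin 4)) V] [IsManifold (𝓡 4) ∞ V]
    (J : ∀ x : V, TangentSpace (𝓡 4) x →L[ℝ] TangentSpace (𝓡 4) x),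
    (∀ (x : V) (v : TangentSpace (𝓡 4) x), J x (J x v) = -v) →
    (∀ x₀ : V, ContMDiffAt (𝓡 4) 𝓘(ℝ, EuclideanSpace ℝ (Fin 4) →L[ℝ] EuclideanSpace ℝ (Fin 4)) ∞
      (inTangentCoordinates (𝓡 4) (𝓡 4) (id : V → V) id (fun x => J x) x₀) x₀) →
    ∀ (N : ℕ) (ι : V → EuclideanSpace ℝ (Fin N)), Topology.IsEmbedding ι →
      ContMDiff (𝓡 4) 𝓘(ℝ, EuclideanSpace ℝ (Fin N)) ∞ ι →
      (∀ x : V, Function.Injective (mfderiv (𝓡 4) 𝓘(ℝ, EuclideanSpace ℝ (Fin N)) ι x)) →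
    ∀ (G : ℂ → V), ContMDiff 𝓘(ℝ, ℂ) (𝓡 4) ∞ G → IsJHolomorphic (𝓡 4) J G →
      ∀ ρ : ℝ, 0 < ρ → Set.InjOn G (Metric.ball (0 : ℂ) ρ) →
        (∀ z ∈ Metric.ball (0 : ℂ) ρ, z ≠ 0 → Function.Injective (mfderiv 𝓘(ℝ, ℂ) (𝓡 4) G z)) →
        ∀ (u : ℕ → ℂ → V),
          (∀ n, ContMDiff 𝓘(ℝ, ℂ) (𝓡 4) ∞ (u n)) → (∀ n, IsJHolomorphic (𝓡 4) J (u n)) →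
          (∀ n, Function.Injective (u n)) →
          (∀ n (z : ℂ), Function.Injective (mfderiv 𝓘(ℝ, ℂ) (𝓡 4) (u n) z)) →
          TendstoUniformlyOn (fun n z => ι (u n z)) (fun z => ι (G z)) atTop
            (Metric.closedBall (0 : ℂ) ρ) →
          Function.Injective (mfderiv 𝓘(ℝ, ℂ) (𝓡 4) G 0)

end Literature.Geometry.Symplectic
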